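import Summits.ResolutionOfSingularities.ResolutionOfSingularities.Theorems.FrobeniusLadderFRationalResolutionMonomialAlgebraVertex
import Summits.ResolutionOfSingularities.ResolutionOfSingularities.Theorems.FrobeniusLadderFRationalResolutionMonoidAlgebraDimension
import Literature.AlgebraicGeometry.Resolution.AffineDomainEquidim
import HarnessLib

/-!
# Crux `FrobeniusLadder.FRationalResolution` (stmt-ResolutionOfSingularities-15317), line `redirect`,
# stub `stub_diagonalizableQuotientResolution` — DIMENSION OF MONOMIAL ALGEBRAS: `dim κ[χᵈ : d ∈ S] = rank ⟨S⟩`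
# (item (E″) of MEMO-15317-leafhand2-g18 §2c, second brick)

For a field `κ` and a finite `S ⊆ ℕⁿ ∖ {0}` with exponent monoid `P = ⟨S⟩`:

* `algEquiv_addMonoidAlgebra` — `κ[χᵈ : d ∈ S] ≃ₐ[κ] κ[P]` (the monomial algebra IS the monoid algebra of `P`);
* `rank_le_finrank_span` — `rank P ≤ rk_ℤ ℤι(P)` for the lattice `ℤι(P) ⊆ ℤⁿ` spanned by `P`;
* ★ `ringKrullDim_eq_rank` — `dim κ[χᵈ : d ∈ S] = rank P` (`≥`: `dim κ[Q] = rk ℤQ`, p. `…MonoidAlgebraDimension`; `≤`: Kato's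
  inequality at the vertex, `…MonomialAlgebraVertex`, and equidimensionality of affine domains);
* ★ `ringKrullDim_localization_vertex_eq_rank` — `dim T_𝔳 = rank P` at the vertex (the `hdim` slot of Kato (3.2) for `(T_𝔳)^`).

Honest label: plumbing toward ONE leaf stub (no stub, crux or summit closed). No definitions, no named facts, no sorry.
[folklore; cite: CoxLittleSchenck2011, §1.1; Matsumura1987, Thm. 5.6] [cite: Kato1994, Lemma (2.3)]
-/

noncomputable section

-- single-problem summit: the doubled namespace component is forced
set_option linter.dupNamespace false

open IsLocalRing MvPolynomial Literature.RingTheory.MvPowerSeries.monoidPowerSeries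
open Literature.AlgebraicGeometry.Resolution

namespace Summit.ResolutionOfSingularities.ResolutionOfSingularities.Theorems.FRationalResolution.MonomialAlgebraDimension

variable (κ : Type) [Field κ] {n : ℕ}

/-- The monomial algebra `κ[χᵈ : d ∈ S] ⊆ κ[x₁,…,xₙ]`. -/
local notation3 "T[" S "]" =>
  Algebra.adjoin κ ((fun d : Fin n →₀ ℕ => MvPolynomial.monomial d (1 : κ)) '' S)

/-- The vertex ideal `(χᵈ : d ∈ S)` of the monomial algebra. -/
local notation3 "V[" S "]" =>
  Ideal.span {v : ↥T[S] | ∃ d ∈ S, (v : MvPolynomial (Fin n) κ) = MvPolynomial.monomial d 1}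

/-- **The monomial algebra is the monoid algebra of its exponent monoid**: `κ[P] ≃ₐ[κ] κ[χᵈ : d ∈ S]` for `P = ⟨S⟩`,
`χᵖ ↦ χᵖ`. [folklore; cite: CoxLittleSchenck2011, §1.1] -/
theorem algEquiv_addMonoidAlgebra (S : Set (Fin n →₀ ℕ)) (P : AddSubmonoid (Fin n →₀ ℕ))
    (hP : AddSubmonoid.closure S = P) :
    ∃ e : AddMonoidAlgebra κ ↥P ≃ₐ[κ] ↥T[S],
      ∀ p : ↥P, (e (AddMonoidAlgebra.single p 1) : MvPolynomial (Fin n) κ) = MvPolynomial.monomial (p : Fin n →₀ ℕ) 1 := by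
  classical
  let g : AddMonoidAlgebra κ ↥P →ₐ[κ] MvPolynomial (Fin n) κ := AddMonoidAlgebra.mapDomainAlgHom κ κ P.subtype
  have hg : ∀ (p : ↥P) (c : κ), g (AddMonoidAlgebra.single p c) = MvPolynomial.monomial (p : Fin n →₀ ℕ) c := by
    intro p c
    rw [AddMonoidAlgebra.mapDomainAlgHom_apply, AddMonoidAlgebra.mapDomain_single]
    rfl
  have hinj : Function.Injective g := by
    intro x y hxy
    rw [AddMonoidAlgebra.mapDomainAlgHom_apply, AddMonoidAlgebra.mapDomainAlgHom_apply] at hxy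
    exact AddMonoidAlgebra.mapDomain_injective Subtype.val_injective hxy
  have hrange : g.range = T[S] := by
    apply le_antisymm
    · rintro _ ⟨x, rfl⟩
      induction x using AddMonoidAlgebra.induction_linear with
      | zero => rw [map_zero]; exact Subalgebra.zero_mem _
      | add x y hx hy => rw [map_add]; exact Subalgebra.add_mem _ hx hy
      | single p c =>
        show g (AddMonoidAlgebra.single p c) ∈ T[S]
        have hc : MvPolynomial.monomial (p : Fin n →₀ ℕ) c = c • MvPolynomial.monomial (p : Fin n →₀ ℕ) (1 : κ) := by
          rw [MvPolynomial.smul_monomial, smul_eq_mul, mul_one]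
        rw [hg, hc]
        exact Subalgebra.smul_mem _ (MonomialAlgebraVertex.monomial_mem_of_mem_closure κ S (hP ▸ p.2)) c
    · refine Algebra.adjoin_le ?_
      rintro _ ⟨d, hd, rfl⟩
      exact ⟨AddMonoidAlgebra.single ⟨d, hP ▸ AddSubmonoid.subset_closure hd⟩ 1, hg _ 1⟩
  refine ⟨(AlgEquiv.ofInjective g hinj).trans (Subalgebra.equivOfEq _ _ hrange), fun p => ?_⟩
  show (g (AddMonoidAlgebra.single p 1) : MvPolynomial (Fin n) κ) = _
  exact hg p 1

/-- **`rank P ≤ rk_ℤ` of the lattice spanned by `P` in `ℤⁿ`** (the `ℚ`-span of `P` is spanned by a `ℤ`-basis of that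
lattice). [folklore] -/
theorem rank_le_finrank_span (P : AddSubmonoid (Fin n →₀ ℕ)) :
    rank P ≤ Module.finrank ℤ ↥(Submodule.span ℤ
      ((P.map (((Nat.castAddMonoidHom ℤ).compLeft (Fin n)).comp Finsupp.coeFnAddHom) : AddSubmonoid (Fin n → ℤ)) :
        Set (Fin n → ℤ))) := by
  classical
  set ι : (Fin n →₀ ℕ) →+ (Fin n → ℤ) := ((Nat.castAddMonoidHom ℤ).compLeft (Fin n)).comp Finsupp.coeFnAddHom with hι
  have hιapp : ∀ (m : Fin n →₀ ℕ) (i : Fin n), ι m i = (m i : ℤ) := fun m i => rfl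
  set N : Submodule ℤ (Fin n → ℤ) := Submodule.span ℤ ((P.map ι : AddSubmonoid (Fin n → ℤ)) : Set (Fin n → ℤ))
  haveI : Module.Finite ℤ ↥N := Module.IsNoetherian.finite ℤ ↥N
  haveI : Module.Free ℤ ↥N := Module.free_of_finite_type_torsion_free'
  let b := Module.finBasis ℤ ↥N
  let castL : (Fin n → ℤ) →ₗ[ℤ] (Fin n → ℚ) := (Int.castAddHom ℚ).toIntLinearMap.compLeft (Fin n)
  have hcast : ∀ (v : Fin n → ℤ) (i : Fin n), castL v i = (v i : ℚ) := fun v i => rfl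
  let F : ↥N →ₗ[ℤ] (Fin n → ℚ) := castL ∘ₗ N.subtype
  -- the `ℚ`-span of `P` lies in the `ℚ`-span of the cast basis vectors
  have hle : Submodule.span ℚ (toRatVec '' (P : Set (Fin n →₀ ℕ))) ≤
      Submodule.span ℚ (Set.range (fun k => F (b k))) := by
    rw [Submodule.span_le]
    rintro _ ⟨p, hp, rfl⟩
    have hpN : ι p ∈ N := Submodule.subset_span ⟨p, hp, rfl⟩
    have h1 : (⟨ι p, hpN⟩ : ↥N) ∈ Submodule.span ℤ (Set.range b) := Module.Basis.mem_span b _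
    have h2 := Submodule.apply_mem_span_image_of_mem_span F h1
    rw [← Set.range_comp] at h2
    have h3 := Submodule.span_le_restrictScalars ℤ ℚ (Set.range (F ∘ b)) h2
    have h4 : F ⟨ι p, hpN⟩ = toRatVec p := by
      funext i
      show castL (ι p) i = _
      rw [hcast, hιapp, toRatVec_apply, Int.cast_natCast]
    rw [Submodule.restrictScalars_mem, h4] at h3
    exact h3
  calc rank P = Module.finrank ℚ ↥(Submodule.span ℚ (toRatVec '' (P : Set (Fin n →₀ ℕ)))) := rfl
    _ ≤ Module.finrank ℚ ↥(Submodule.span ℚ (Set.range (fun k => F (b k)))) := Submodule.finrank_mono hle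
    _ ≤ Fintype.card (Fin (Module.finrank ℤ ↥N)) := finrank_range_le_card _
    _ = Module.finrank ℤ ↥N := Fintype.card_fin _

/-- ★ **`dim κ[χᵈ : d ∈ S] = rank ⟨S⟩`** for a finite `S ⊆ ℕⁿ ∖ {0}`. [folklore; cite: Matsumura1987, Thm. 5.6]
[cite: Kato1994, Lemma (2.3)] -/
theorem ringKrullDim_eq_rank (S : Set (Fin n →₀ ℕ)) (hS : S.Finite) (h0 : (0 : Fin n →₀ ℕ) ∉ S)
    (P : AddSubmonoid (Fin n →₀ ℕ)) (hP : AddSubmonoid.closure S = P) :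
    ringKrullDim (↥T[S]) = rank P := by
  classical
  haveI : Algebra.FiniteType κ (↥T[S]) := MonomialAlgebraVertex.finiteType κ S hS
  haveI h𝔳 : (V[S]).IsMaximal := MonomialAlgebraVertex.vertexIdeal_isMaximal κ S h0
  have hPfg : P.FG := ⟨hS.toFinset, by rw [Set.Finite.coe_toFinset, hP]⟩
  -- `dim T = ht 𝔳 = dim T_𝔳`
  have hT : ringKrullDim (↥T[S]) = ringKrullDim (Localization.AtPrime V[S]) := by
    rw [IsLocalization.AtPrime.ringKrullDim_eq_height (V[S]) (Localization.AtPrime V[S]),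
      height_eq_ringKrullDim_of_isMaximal κ (V[S])]
  apply le_antisymm
  · rw [hT]
    exact MonomialAlgebraVertex.ringKrullDim_localization_le_rank κ S hS h0 P hP
  · -- `T ≅ κ[P] ≅ κ[ι P]`, `dim κ[ι P] = rk ℤι(P) ≥ rank P`
    set ι : (Fin n →₀ ℕ) →+ (Fin n → ℤ) := ((Nat.castAddMonoidHom ℤ).compLeft (Fin n)).comp Finsupp.coeFnAddHom
      with hι
    have hιapp : ∀ (m : Fin n →₀ ℕ) (i : Fin n), ι m i = (m i : ℤ) := fun m i => rfl
    have hιinj : Function.Injective ι := by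
      intro a b hab
      ext i
      have h := congrFun hab i
      rw [hιapp, hιapp] at h
      exact_mod_cast h
    obtain ⟨e, -⟩ := algEquiv_addMonoidAlgebra κ S P hP
    let eQ : ↥P ≃+ ↥(P.map ι) := AddSubmonoid.equivMapOfInjective P ι hιinj
    let e₁ : AddMonoidAlgebra κ ↥P ≃ₐ[κ] AddMonoidAlgebra κ ↥(P.map ι) := AddMonoidAlgebra.domCongr κ κ eQ
    rw [ringKrullDim_eq_of_ringEquiv (e.symm.trans e₁).toRingEquiv,
      ringKrullDim_addMonoidAlgebra_eq_finrank_span κ (P.map ι) (hPfg.map ι)]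
    exact_mod_cast rank_le_finrank_span P

/-- ★ **`dim T_𝔳 = rank ⟨S⟩` at the vertex** of the monomial algebra `T = κ[χᵈ : d ∈ S]` — the dimension slot of
Kato's structure theorem (3.2) for `(T_𝔳)^`. [folklore; cite: Matsumura1987, Thm. 5.6] [cite: Kato1994, Lemma (2.3)] -/
theorem ringKrullDim_localization_vertex_eq_rank (S : Set (Fin n →₀ ℕ)) (hS : S.Finite) (h0 : (0 : Fin n →₀ ℕ) ∉ S)
    [h𝔳 : (V[S]).IsMaximal] (P : AddSubmonoid (Fin n →₀ ℕ)) (hP : AddSubmonoid.closure S = P) :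
    ringKrullDim (Localization.AtPrime V[S]) = rank P := by
  haveI : Algebra.FiniteType κ (↥T[S]) := MonomialAlgebraVertex.finiteType κ S hS
  rw [IsLocalization.AtPrime.ringKrullDim_eq_height (V[S]) (Localization.AtPrime V[S]),
    height_eq_ringKrullDim_of_isMaximal κ (V[S])]
  exact ringKrullDim_eq_rank κ S hS h0 P hP

end Summit.ResolutionOfSingularities.ResolutionOfSingularities.Theorems.FRationalResolution.MonomialAlgebraDimension

end
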